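import Literature.NumberTheory.Automorphic.UnipotentTateDomain
import Literature.NumberTheory.Automorphic.AdeleQuotientFourier
import Literature.NumberTheory.Automorphic.NewformAdelisationCuspidal
import HarnessLib

/-!
# Whittaker coefficients on `GL₂` as Fourier coefficients on `𝔸_K ⧸ K`: Bessel's inequality

Topic `NumberTheory/Automorphic`; namespace `Literature.NumberTheory.Automorphic`. A brick of the
mean-square route to Jacquet–Shalika's Theorem (5.3) for `GL₂` (`StandardLFunctionData.multipliable_L`;
files `JacquetShalikaSchurSelfSum`, `WhittakerCoeffCuspidal`, `UnipotentTateDomain`,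
`InvariantMeasureDominationExplicit`). For `n = 2` the unipotent radical `N₂(𝔸_K)` is the additive
group `𝔸_K` (`n(x) = (1 x; 0 1)`, Mathlib `upperRightHom`), `N₂(K) \ N₂(𝔸_K)` is the compact
group `𝔸_K ⧸ K`, and for a left `GL₂(K)`-invariant `φ` the global Whittaker coefficients
`W_φ(d(ξ) g)`, `d(ξ) = diag(ξ, 1)`, `ξ ∈ Kˣ`, are the Fourier coefficients of the continuous
function `x + K ↦ φ(n(x) g)`. This file proves exactly this dictionary and draws the two
consequences used by the mean-square method:

* `unipotentGL2`, `diagGL2`, `ratDiagGL2`, `unipotentHomeomorphGL2` — `N₂(R) ≅ R`,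
  `d(a,1) n(x) d(a,1)⁻¹ = n(a x)`, `ψ_N(n(x)) = ψ(x)` for `n = 2`, rationality of `n(k)`, `d(ξ)`;
* `unipotentPeriodization hφ g` — the descent of `x ↦ φ(n(x) g)` to `𝔸_K ⧸ K` (`periodicLift` of
  `AdeleQuotientFourier`), continuous for continuous `φ`, with
  `Φ_{d(ξ) g}(ξ q) = Φ_g(q)` (`unipotentPeriodization_mulQuot`);
* `entryMeasure ν` — the additive Haar measure on `𝔸_K` obtained from a Haar measure `ν` on
  `N₂(𝔸_K)` along `u ↦ u₀₁`; Tate's box `𝓕_N = unipotentTateDomain 2 K` is the preimage of Tate's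
  domain `D`, so `entryMeasure ν (D) = ν(𝓕_N)` and integrals over `D` are integrals over `𝓕_N`;
* `integral_conj_adeleQuotChar_mul_unipotentPeriodization` — **`∫ conj ψ(ξ x) φ(n(x) g) dx =
  W_φ(d(ξ) g)`** for `ξ ∈ Kˣ` (`whittakerCoeff ν 𝓕_N ψ φ`, `ψ = adeleAddChar K`), the change of
  variables `x ↦ ξ x` being made on the compact quotient where it preserves the probability Haar
  measure (`integral_comp_mulQuot`; no product formula needed); `integral_unipotentPeriodization` —
  the constant term is `ν(𝓕_N)⁻¹ ∫_{𝓕_N} φ(u g) dν`;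
* `sum_norm_sq_whittakerCoeff_ratDiagGL2_le`, `tsum_enorm_sq_whittakerCoeff_ratDiagGL2_le` —
  **Bessel's inequality** `∑_{ξ ∈ Kˣ} |W_φ(d(ξ) g)|² ≤ ν(𝓕_N)⁻¹ ∫_{𝓕_N} |φ(u g)|² dν(u)`;
* `exists_whittakerCoeff_ne_zero_of_cuspidal` — **genericity**: a continuous, left-invariant,
  non-zero `φ` with vanishing constant terms along `N₂` has a non-zero Whittaker coefficient
  (completeness of the characters of `𝔸_K ⧸ K`).

Everything is proved; folklore (the Fourier expansion of `GL₂` automorphic forms along `N`: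
Jacquet–Langlands (1970); Gelbart, *Automorphic forms on adele groups* (1975), §3; Cogdell,
*Analytic theory of L-functions for GL_n* (2004), §1.1, for `GL_n`).

## References

* S. Gelbart, *Automorphic forms on adele groups*, Ann. of Math. Stud. 83 (1975), §3.
* J. W. Cogdell, *Analytic theory of L-functions for GL_n*, in J. Bernstein, S. Gelbart (eds.),
  *An Introduction to the Langlands Program* (2004), §1.1 [CogdellAnalyticTheory2004].
* J. W. S. Cassels, A. Fröhlich (eds.), *Algebraic Number Theory* (1967), Ch. XV (Tate), §4.1
  [CasselsFrohlichANT1967].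
-/

noncomputable section

open MeasureTheory Measure NumberField IsDedekindDomain Matrix Set
open scoped MatrixGroups ENNReal ComplexConjugate

namespace Literature.NumberTheory.Automorphic

/-! ### `N₂(R) ≅ R`: the unipotent elements `n(x) = (1 x; 0 1)` -/

section Ring

variable {R S : Type*} [CommRing R] [CommRing S]

/-- `n(x) = (1 x; 0 1)` is upper unitriangular. [folklore] -/
theorem upperRightHom_mem_upperUnitriangular (x : R) :
    (Matrix.GeneralLinearGroup.upperRightHom x : GL (Fin 2) R) ∈ upperUnitriangular (Fin 2) R := by
  rw [mem_upperUnitriangular_iff, coe_upperRightHom]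
  refine ⟨fun i j hij => ?_, fun i => ?_⟩
  · fin_cases i <;> fin_cases j <;> simp at hij ⊢
  · fin_cases i <;> simp

/-- `n(x) = (1 x; 0 1)` as an element of `N₂(R) = upperUnitriangular (Fin 2) R`. [folklore] -/
def unipotentGL2 (x : R) : ↥(upperUnitriangular (Fin 2) R) :=
  ⟨Matrix.GeneralLinearGroup.upperRightHom x, upperRightHom_mem_upperUnitriangular x⟩

/-- The matrix of `n(x)`. [folklore] -/
@[simp]
theorem coe_unipotentGL2 (x : R) :
    (((unipotentGL2 x : ↥(upperUnitriangular (Fin 2) R)) : GL (Fin 2) R) : Matrix (Fin 2) (Fin 2) R) =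
      !![1, x; 0, 1] :=
  coe_upperRightHom x

/-- `n(x + y) = n(x) n(y)`. [folklore] -/
theorem unipotentGL2_add (x y : R) : unipotentGL2 (x + y) = unipotentGL2 x * unipotentGL2 y :=
  Subtype.ext (AddChar.map_add_eq_mul _ x y)

/-- `n(0) = 1`. [folklore] -/
@[simp]
theorem unipotentGL2_zero : unipotentGL2 (0 : R) = 1 :=
  Subtype.ext (AddChar.map_zero_eq_one _)

/-- The `(0,1)` entry of `n(x)` is `x`. [folklore] -/
@[simp]
theorem unipotentGL2_apply_zero_one (x : R) :
    (((unipotentGL2 x : ↥(upperUnitriangular (Fin 2) R)) : GL (Fin 2) R) : Matrix (Fin 2) (Fin 2) R) 0 1 = x := by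
  rw [coe_unipotentGL2]; rfl

/-- Every `u ∈ N₂(R)` is `n(u₀₁)`. [folklore] -/
theorem unipotentGL2_entry (u : ↥(upperUnitriangular (Fin 2) R)) :
    unipotentGL2 (((u : GL (Fin 2) R) : Matrix (Fin 2) (Fin 2) R) 0 1) = u := by
  obtain ⟨hut, hud⟩ := (mem_upperUnitriangular_iff (u : GL (Fin 2) R)).1 u.2
  refine Subtype.ext (Units.ext ?_)
  rw [coe_unipotentGL2]
  ext i j
  fin_cases i <;> fin_cases j
  · simpa using (hud 0).symm
  · simp
  · simpa using (hut (show ((0 : Fin 2) : Fin 2) < 1 by decide)).symm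
  · simpa using (hud 1).symm

/-- `x ↦ n(x)` is injective. [folklore] -/
theorem unipotentGL2_injective : Function.Injective (unipotentGL2 : R → ↥(upperUnitriangular (Fin 2) R)) :=
  fun x y h => by simpa using congrArg (fun u : ↥(upperUnitriangular (Fin 2) R) =>
    ((u : GL (Fin 2) R) : Matrix (Fin 2) (Fin 2) R) 0 1) h

/-- For `n = 2` the super-diagonal sum of `u ∈ N₂(R)` is its entry `u₀₁`. [folklore] -/
theorem superdiagSum_fin_two (u : ↥(upperUnitriangular (Fin 2) R)) :
    superdiagSum u = ((u : GL (Fin 2) R) : Matrix (Fin 2) (Fin 2) R) 0 1 := by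
  rw [superdiagSum_def, Fin.sum_univ_two, Fin.sum_univ_two, Fin.sum_univ_two]
  simp

/-- For `n = 2` the generic character is `ψ_N(u) = ψ(u₀₁)`. [folklore] -/
theorem whittakerCharFun_fin_two (ψ : AddChar R Circle) (u : ↥(upperUnitriangular (Fin 2) R)) :
    whittakerCharFun ψ u = ψ (((u : GL (Fin 2) R) : Matrix (Fin 2) (Fin 2) R) 0 1) := by
  rw [whittakerCharFun_apply, superdiagSum_fin_two]

/-- `ψ_N(n(x)) = ψ(x)`. [folklore] -/
theorem whittakerCharFun_unipotentGL2 (ψ : AddChar R Circle) (x : R) :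
    whittakerCharFun ψ (unipotentGL2 x) = ψ x := by
  rw [whittakerCharFun_fin_two, unipotentGL2_apply_zero_one]

/-- The diagonal matrix `d(a, b) = diag(a, b) ∈ GL₂(R)` (`glDiagonal` of `GLnAdelicStructure`).
[folklore] -/
def diagGL2 (a b : Rˣ) : GL (Fin 2) R := glDiagonal 2 R ![a, b]

/-- The matrix of `d(a, b)`. [folklore] -/
@[simp]
theorem coe_diagGL2 (a b : Rˣ) :
    ((diagGL2 a b : GL (Fin 2) R) : Matrix (Fin 2) (Fin 2) R) = !![(a : R), 0; 0, (b : R)] := by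
  rw [diagGL2, coe_glDiagonal]
  ext i j
  fin_cases i <;> fin_cases j <;> simp

/-- `d(a, b)` is multiplicative in `(a, b)`. [folklore] -/
theorem diagGL2_mul (a b a' b' : Rˣ) : diagGL2 (a * a') (b * b') = diagGL2 a b * diagGL2 a' b' := by
  rw [diagGL2, diagGL2, diagGL2, ← map_mul]
  congr 1
  ext i
  fin_cases i <;> rfl

/-- `d(1, 1) = 1`. [folklore] -/
@[simp]
theorem diagGL2_one : diagGL2 (1 : Rˣ) 1 = 1 := by
  rw [diagGL2, ← map_one (glDiagonal 2 R)]
  congr 1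
  ext i
  fin_cases i <;> rfl

/-- **`d(a, 1) n(x) d(a, 1)⁻¹ = n(a x)`**: the torus dilates the unipotent radical. [folklore] -/
theorem diagGL2_mul_unipotentGL2_mul_inv (a : Rˣ) (x : R) :
    diagGL2 a 1 * ((unipotentGL2 x : ↥(upperUnitriangular (Fin 2) R)) : GL (Fin 2) R) * (diagGL2 a 1)⁻¹ =
      ((unipotentGL2 ((a : R) * x) : ↥(upperUnitriangular (Fin 2) R)) : GL (Fin 2) R) := by
  rw [mul_inv_eq_iff_eq_mul]
  refine Units.ext ?_
  rw [Units.val_mul, Units.val_mul, coe_diagGL2, coe_unipotentGL2, coe_unipotentGL2]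
  ext i j
  fin_cases i <;> fin_cases j <;> simp [Matrix.mul_apply, Fin.sum_univ_two]

/-- `d(a, 1) n(x) = n(a x) d(a, 1)`. [folklore] -/
theorem diagGL2_mul_unipotentGL2 (a : Rˣ) (x : R) :
    diagGL2 a 1 * ((unipotentGL2 x : ↥(upperUnitriangular (Fin 2) R)) : GL (Fin 2) R) =
      ((unipotentGL2 ((a : R) * x) : ↥(upperUnitriangular (Fin 2) R)) : GL (Fin 2) R) * diagGL2 a 1 := by
  rw [← diagGL2_mul_unipotentGL2_mul_inv, inv_mul_cancel_right]

/-- Naturality of `n(x)` in the ring: `map f n(x) = n(f x)`. [folklore] -/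
theorem map_unipotentGL2 (f : R →+* S) (x : R) :
    Matrix.GeneralLinearGroup.map f ((unipotentGL2 x : ↥(upperUnitriangular (Fin 2) R)) : GL (Fin 2) R) =
      ((unipotentGL2 (f x) : ↥(upperUnitriangular (Fin 2) S)) : GL (Fin 2) S) :=
  map_upperRightHom f x

/-- Naturality of `d(a, b)` in the ring. [folklore] -/
theorem map_diagGL2 (f : R →+* S) (a b : Rˣ) :
    Matrix.GeneralLinearGroup.map f (diagGL2 a b) = diagGL2 (Units.map (f : R →* S) a) (Units.map (f : R →* S) b) := by
  refine Units.ext ?_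
  ext i j
  rw [Matrix.GeneralLinearGroup.map_apply, coe_diagGL2, coe_diagGL2]
  fin_cases i <;> fin_cases j <;> simp

section Topology

variable [TopologicalSpace R] [IsTopologicalRing R]

/-- `x ↦ n(x)` is continuous into the units topology. [folklore] -/
theorem continuous_unipotentGL2 : Continuous (unipotentGL2 : R → ↥(upperUnitriangular (Fin 2) R)) := by
  refine Continuous.subtype_mk ?_ _
  refine Units.continuous_iff.2 ⟨?_, ?_⟩
  · have : (Units.val ∘ (Matrix.GeneralLinearGroup.upperRightHom : AddChar R (GL (Fin 2) R))) =
        fun x => !![1, x; 0, 1] := funext fun x => coe_upperRightHom x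
    rw [this]
    refine continuous_matrix fun i j => ?_
    fin_cases i <;> fin_cases j <;> simp <;> fun_prop
  · have : (fun x : R => ((↑((Matrix.GeneralLinearGroup.upperRightHom x : GL (Fin 2) R)⁻¹)) : Matrix (Fin 2) (Fin 2) R)) =
        fun x => !![1, -x; 0, 1] := by
      funext x
      rw [← AddChar.map_neg_eq_inv, coe_upperRightHom]
    rw [this]
    refine continuous_matrix fun i j => ?_
    fin_cases i <;> fin_cases j <;> simp <;> fun_prop

omit [IsTopologicalRing R] in
/-- `u ↦ u₀₁` is continuous on `N₂(R)`. [folklore] -/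
theorem continuous_entry_zero_one :
    Continuous fun u : ↥(upperUnitriangular (Fin 2) R) => ((u : GL (Fin 2) R) : Matrix (Fin 2) (Fin 2) R) 0 1 :=
  (Units.continuous_val.comp continuous_subtype_val).matrix_elem 0 1

/-- **`N₂(R) ≅ R` as topological spaces**: `x ↦ n(x)` with inverse `u ↦ u₀₁`. [folklore] -/
def unipotentHomeomorphGL2 : R ≃ₜ ↥(upperUnitriangular (Fin 2) R) where
  toFun := unipotentGL2
  invFun u := ((u : GL (Fin 2) R) : Matrix (Fin 2) (Fin 2) R) 0 1
  left_inv x := unipotentGL2_apply_zero_one x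
  right_inv u := unipotentGL2_entry u
  continuous_toFun := continuous_unipotentGL2
  continuous_invFun := continuous_entry_zero_one

/-- `unipotentHomeomorphGL2 x = n(x)` (definitional). [folklore] -/
@[simp] theorem unipotentHomeomorphGL2_apply (x : R) : unipotentHomeomorphGL2 x = unipotentGL2 x := rfl

/-- The inverse of `unipotentHomeomorphGL2` is `u ↦ u₀₁` (definitional). [folklore] -/
@[simp] theorem unipotentHomeomorphGL2_symm_apply (u : ↥(upperUnitriangular (Fin 2) R)) :
    (unipotentHomeomorphGL2 (R := R)).symm u = ((u : GL (Fin 2) R) : Matrix (Fin 2) (Fin 2) R) 0 1 := rfl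

end Topology

end Ring

/-! ### Rational unipotent and torus elements in `GL₂(𝔸_K)` -/

section Adelic

variable (K : Type) [Field K] [NumberField K]

/-- Rational unipotents lie in the arithmetic subgroup `GL₂(K) ≤ GL₂(𝔸_K)`. [folklore] -/
theorem unipotentGL2_algebraMap_mem_arithmeticSubgroup (k : K) :
    ((unipotentGL2 (algebraMap K (AdeleRing (𝓞 K) K) k) : ↥(adelicUnipotent 2 K)) :
        GL (Fin 2) (AdeleRing (𝓞 K) K)) ∈ (AdelicGroupData.gl 2 K).arithmeticSubgroup :=
  ⟨((unipotentGL2 k : ↥(upperUnitriangular (Fin 2) K)) : GL (Fin 2) K), map_unipotentGL2 _ k⟩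

/-- The **rational torus element** `d(ξ) = diag(ξ, 1) ∈ GL₂(𝔸_K)` for `ξ ∈ Kˣ` (diagonally
embedded). [folklore] -/
def ratDiagGL2 (ξ : Kˣ) : GL (Fin 2) (AdeleRing (𝓞 K) K) :=
  diagGL2 (Units.map (algebraMap K (AdeleRing (𝓞 K) K) : K →* AdeleRing (𝓞 K) K) ξ) 1

/-- `d(ξ)` is the image of `diag(ξ, 1) ∈ GL₂(K)`. [folklore] -/
theorem map_diagGL2_eq_ratDiagGL2 (ξ : Kˣ) :
    Matrix.GeneralLinearGroup.map (algebraMap K (AdeleRing (𝓞 K) K)) (diagGL2 ξ 1) = ratDiagGL2 K ξ := by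
  rw [map_diagGL2, map_one]; rfl

/-- `d(ξ) ∈ GL₂(K)`. [folklore] -/
theorem ratDiagGL2_mem_arithmeticSubgroup (ξ : Kˣ) :
    ratDiagGL2 K ξ ∈ (AdelicGroupData.gl 2 K).arithmeticSubgroup :=
  ⟨diagGL2 ξ 1, map_diagGL2_eq_ratDiagGL2 K ξ⟩

/-- `ξ ↦ d(ξ)` is multiplicative. [folklore] -/
theorem ratDiagGL2_mul (ξ ξ' : Kˣ) : ratDiagGL2 K (ξ * ξ') = ratDiagGL2 K ξ * ratDiagGL2 K ξ' := by
  rw [ratDiagGL2, ratDiagGL2, ratDiagGL2, map_mul, ← diagGL2_mul, mul_one]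

/-- `d(1) = 1`. [folklore] -/
@[simp]
theorem ratDiagGL2_one : ratDiagGL2 K 1 = 1 := by
  rw [ratDiagGL2, map_one, diagGL2_one]

/-- `d(ξ) n(x) = n(ξ x) d(ξ)`. [folklore] -/
theorem ratDiagGL2_mul_unipotentGL2 (ξ : Kˣ) (x : AdeleRing (𝓞 K) K) :
    ratDiagGL2 K ξ * ((unipotentGL2 x : ↥(adelicUnipotent 2 K)) : GL (Fin 2) (AdeleRing (𝓞 K) K)) =
      ((unipotentGL2 (algebraMap K (AdeleRing (𝓞 K) K) ξ * x) : ↥(adelicUnipotent 2 K)) :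
          GL (Fin 2) (AdeleRing (𝓞 K) K)) * ratDiagGL2 K ξ :=
  diagGL2_mul_unipotentGL2 _ x

variable {K}

/-! ### Left `GL₂(K)`-invariant functions along `N₂`: descent to `𝔸_K ⧸ K` -/

section Descent

variable {φ : GL (Fin 2) (AdeleRing (𝓞 K) K) → ℂ}

/-- For `φ` left `GL₂(K)`-invariant, `x ↦ φ(n(x) g)` is `K`-periodic. [folklore] -/
theorem apply_unipotentGL2_algebraMap_add_mul (hφ : IsLeftInvariant (AdelicGroupData.gl 2 K) φ)
    (g : GL (Fin 2) (AdeleRing (𝓞 K) K)) (k : K) (x : AdeleRing (𝓞 K) K) :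
    φ (((unipotentGL2 (algebraMap K (AdeleRing (𝓞 K) K) k + x) : ↥(adelicUnipotent 2 K)) :
        GL (Fin 2) (AdeleRing (𝓞 K) K)) * g) =
      φ (((unipotentGL2 x : ↥(adelicUnipotent 2 K)) : GL (Fin 2) (AdeleRing (𝓞 K) K)) * g) := by
  rw [unipotentGL2_add, Subgroup.coe_mul, mul_assoc]
  exact hφ _ (unipotentGL2_algebraMap_mem_arithmeticSubgroup K k) _

/-- **The `N₂`-periodisation** of a left `GL₂(K)`-invariant `φ` at `g`: the function
`x + K ↦ φ(n(x) g)` on the compact group `𝔸_K ⧸ K` (`periodicLift`). [folklore] -/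
def unipotentPeriodization (hφ : IsLeftInvariant (AdelicGroupData.gl 2 K) φ)
    (g : GL (Fin 2) (AdeleRing (𝓞 K) K)) : adeleQuotient K → ℂ :=
  periodicLift (fun x => φ (((unipotentGL2 x : ↥(adelicUnipotent 2 K)) :
    GL (Fin 2) (AdeleRing (𝓞 K) K)) * g)) fun k x => apply_unipotentGL2_algebraMap_add_mul hφ g k x

/-- `unipotentPeriodization hφ g (x + K) = φ(n(x) g)` (definitional). [folklore] -/
@[simp]
theorem unipotentPeriodization_mk (hφ : IsLeftInvariant (AdelicGroupData.gl 2 K) φ)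
    (g : GL (Fin 2) (AdeleRing (𝓞 K) K)) (x : AdeleRing (𝓞 K) K) :
    unipotentPeriodization hφ g (QuotientAddGroup.mk x) =
      φ (((unipotentGL2 x : ↥(adelicUnipotent 2 K)) : GL (Fin 2) (AdeleRing (𝓞 K) K)) * g) := rfl

/-- The periodisation of a continuous `φ` is continuous. [folklore] -/
theorem continuous_unipotentPeriodization (hφ : IsLeftInvariant (AdelicGroupData.gl 2 K) φ)
    (hφc : Continuous φ) (g : GL (Fin 2) (AdeleRing (𝓞 K) K)) :
    Continuous (unipotentPeriodization hφ g) :=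
  continuous_periodicLift _ (hφc.comp ((continuous_subtype_val.comp continuous_unipotentGL2).mul
    continuous_const))

/-- **Equivariance under the rational torus**: `Φ_{d(ξ) g}(ξ q) = Φ_g(q)`, i.e.
`φ(n(ξ x) d(ξ) g) = φ(d(ξ) n(x) g) = φ(n(x) g)`. [folklore] -/
theorem unipotentPeriodization_mulQuot (hφ : IsLeftInvariant (AdelicGroupData.gl 2 K) φ)
    (g : GL (Fin 2) (AdeleRing (𝓞 K) K)) (ξ : Kˣ) (q : adeleQuotient K) :
    unipotentPeriodization hφ (ratDiagGL2 K ξ * g) (mulQuot K (ξ : K) q) =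
      unipotentPeriodization hφ g q := by
  obtain ⟨x, rfl⟩ := QuotientAddGroup.mk_surjective q
  rw [mulQuot_mk, unipotentPeriodization_mk, unipotentPeriodization_mk, ← mul_assoc,
    ← ratDiagGL2_mul_unipotentGL2, mul_assoc]
  exact hφ _ (ratDiagGL2_mem_arithmeticSubgroup K ξ) _

end Descent

/-! ### Transport of Haar measure along `N₂(𝔸_K) ≅ 𝔸_K` -/

section Transport

/-- For `n = 2`, Tate's box `𝓕_N` is the preimage of Tate's domain `D` under `u ↦ u₀₁`.
[folklore] -/
theorem unipotentTateDomain_two_eq_preimage :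
    unipotentTateDomain 2 K = (fun u : ↥(adelicUnipotent 2 K) =>
      ((u : GL (Fin 2) (AdeleRing (𝓞 K) K)) : Matrix (Fin 2) (Fin 2) (AdeleRing (𝓞 K) K)) 0 1) ⁻¹'
        adeleFundamentalDomain K := by
  ext u
  simp only [mem_unipotentTateDomain_iff, mem_preimage]
  constructor
  · intro h; exact h 0 1 (by decide)
  · intro h i j hij
    fin_cases i <;> fin_cases j
    · exact absurd hij (lt_irrefl _)
    · exact h
    · exact absurd hij (by decide)
    · exact absurd hij (lt_irrefl _)

variable [MeasurableSpace ↥(adelicUnipotent 2 K)] [BorelSpace ↥(adelicUnipotent 2 K)]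
  [MeasurableSpace (AdeleRing (𝓞 K) K)] [BorelSpace (AdeleRing (𝓞 K) K)]

/-- The entry map `u ↦ u₀₁ : N₂(𝔸_K) → 𝔸_K` is a measurable embedding (a homeomorphism).
[folklore] -/
theorem measurableEmbedding_entry_zero_one :
    MeasurableEmbedding fun u : ↥(adelicUnipotent 2 K) =>
      ((u : GL (Fin 2) (AdeleRing (𝓞 K) K)) : Matrix (Fin 2) (Fin 2) (AdeleRing (𝓞 K) K)) 0 1 :=
  (unipotentHomeomorphGL2 (R := AdeleRing (𝓞 K) K)).symm.measurableEmbedding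

/-- **The additive measure on `𝔸_K` attached to a measure `ν` on `N₂(𝔸_K)`**: the push-forward
along `u ↦ u₀₁`. [folklore] -/
def entryMeasure (ν : Measure ↥(adelicUnipotent 2 K)) : Measure (AdeleRing (𝓞 K) K) :=
  ν.map fun u : ↥(adelicUnipotent 2 K) =>
    ((u : GL (Fin 2) (AdeleRing (𝓞 K) K)) : Matrix (Fin 2) (Fin 2) (AdeleRing (𝓞 K) K)) 0 1

/-- `entryMeasure ν (A) = ν (n(A))` for measurable `A` (as a preimage under the entry map).
[folklore] -/
theorem entryMeasure_apply (ν : Measure ↥(adelicUnipotent 2 K)) {A : Set (AdeleRing (𝓞 K) K)}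
    (hA : MeasurableSet A) :
    entryMeasure ν A = ν ((fun u : ↥(adelicUnipotent 2 K) =>
      ((u : GL (Fin 2) (AdeleRing (𝓞 K) K)) : Matrix (Fin 2) (Fin 2) (AdeleRing (𝓞 K) K)) 0 1) ⁻¹' A) :=
  Measure.map_apply measurableEmbedding_entry_zero_one.measurable hA

/-- The push-forward of a Haar measure on `N₂(𝔸_K)` along `N₂(𝔸_K) ≅ 𝔸_K` is an additive Haar
measure on `𝔸_K`. [folklore] -/
instance isAddHaarMeasure_entryMeasure (ν : Measure ↥(adelicUnipotent 2 K)) [IsHaarMeasure ν] :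
    (entryMeasure ν).IsAddHaarMeasure := by
  set e := (unipotentHomeomorphGL2 (R := AdeleRing (𝓞 K) K)).symm with he
  have hν : entryMeasure ν = ν.map e := rfl
  have hme : MeasurableEmbedding e := e.measurableEmbedding
  haveI : IsFiniteMeasureOnCompacts (entryMeasure ν) := ⟨fun C hC => by
    rw [hν, hme.map_apply, ← e.image_symm]
    exact (hC.image e.symm.continuous).measure_lt_top⟩
  haveI : (entryMeasure ν).IsOpenPosMeasure := ⟨fun U hU hne => by
    rw [hν, hme.map_apply]
    exact (hU.preimage e.continuous).measure_ne_zero ν (e.surjective.nonempty_preimage.2 hne)⟩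
  haveI : (entryMeasure ν).IsAddLeftInvariant := ⟨fun x => by
    rw [hν, Measure.map_map (measurable_const_add x) hme.measurable]
    have hcomp : (fun y => x + y) ∘ e = e ∘ fun u => unipotentGL2 x * u := by
      funext u
      simp only [Function.comp_apply, he, unipotentHomeomorphGL2_symm_apply]
      conv_rhs => rw [← unipotentGL2_entry u, ← unipotentGL2_add, unipotentGL2_apply_zero_one]
    rw [hcomp, ← Measure.map_map hme.measurable (measurable_const_mul _), map_mul_left_eq_self]⟩
  exact IsAddHaarMeasure.mk

/-- `entryMeasure ν (D) = ν (𝓕_N)`. [folklore] -/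
theorem entryMeasure_adeleFundamentalDomain (ν : Measure ↥(adelicUnipotent 2 K)) :
    entryMeasure ν (adeleFundamentalDomain K) = ν (unipotentTateDomain 2 K) := by
  rw [entryMeasure_apply ν (measurableSet_adeleFundamentalDomain K), unipotentTateDomain_two_eq_preimage]

/-- Integrals over `D` against `entryMeasure ν` are integrals over `𝓕_N` against `ν`.
[folklore] -/
theorem setIntegral_entryMeasure {E : Type*} [NormedAddCommGroup E] [NormedSpace ℝ E]
    (ν : Measure ↥(adelicUnipotent 2 K)) (G : AdeleRing (𝓞 K) K → E) :
    ∫ x in adeleFundamentalDomain K, G x ∂(entryMeasure ν) =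
      ∫ u in unipotentTateDomain 2 K,
        G (((u : GL (Fin 2) (AdeleRing (𝓞 K) K)) : Matrix (Fin 2) (Fin 2) (AdeleRing (𝓞 K) K)) 0 1) ∂ν := by
  rw [entryMeasure, measurableEmbedding_entry_zero_one.setIntegral_map, unipotentTateDomain_two_eq_preimage]

end Transport

/-! ### Whittaker coefficients are Fourier coefficients; Bessel's inequality -/

section Fourier

variable [MeasurableSpace ↥(adelicUnipotent 2 K)] [BorelSpace ↥(adelicUnipotent 2 K)]
  [MeasurableSpace (AdeleRing (𝓞 K) K)] [BorelSpace (AdeleRing (𝓞 K) K)]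
  [MeasurableSpace (adeleQuotient K)] [BorelSpace (adeleQuotient K)]
  {φ : GL (Fin 2) (AdeleRing (𝓞 K) K) → ℂ}

/-- Integrals over `𝔸_K ⧸ K` of the periodisation, computed on `𝓕_N`:
`∫ F(q) Φ_g(q) dq = ν(𝓕_N)⁻¹ ∫_{𝓕_N} F(u₀₁ + K) φ(u g) dν(u)` for continuous `F`. [folklore] -/
theorem integral_mul_unipotentPeriodization (hφ : IsLeftInvariant (AdelicGroupData.gl 2 K) φ)
    (hφc : Continuous φ) (ν : Measure ↥(adelicUnipotent 2 K)) [IsHaarMeasure ν]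
    {F : adeleQuotient K → ℂ} (hF : Continuous F) (g : GL (Fin 2) (AdeleRing (𝓞 K) K)) :
    ∫ q, F q * unipotentPeriodization hφ g q ∂(adeleQuotHaar K) =
      ((ν (unipotentTateDomain 2 K)).toReal⁻¹ : ℝ) •
        ∫ u in unipotentTateDomain 2 K,
          F (QuotientAddGroup.mk (((u : GL (Fin 2) (AdeleRing (𝓞 K) K)) :
            Matrix (Fin 2) (Fin 2) (AdeleRing (𝓞 K) K)) 0 1)) *
          φ ((u : GL (Fin 2) (AdeleRing (𝓞 K) K)) * g) ∂ν := by
  set lam := entryMeasure ν with hlam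
  have hcont : Continuous fun q => F q * unipotentPeriodization hφ g q :=
    hF.mul (continuous_unipotentPeriodization hφ hφc g)
  have h := integral_comp_mk_eq_smul K lam (F := fun q => F q * unipotentPeriodization hφ g q)
    hcont.aestronglyMeasurable
  have hpos : 0 < (lam (adeleFundamentalDomain K)).toReal :=
    ENNReal.toReal_pos (measure_adeleFundamentalDomain_pos K lam).ne'
      (measure_adeleFundamentalDomain_lt_top K lam).ne
  have h' : ∫ q, F q * unipotentPeriodization hφ g q ∂(adeleQuotHaar K) =
      (lam (adeleFundamentalDomain K)).toReal⁻¹ •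
        ∫ x in adeleFundamentalDomain K, F (QuotientAddGroup.mk x) *
          unipotentPeriodization hφ g (QuotientAddGroup.mk x) ∂lam := by
    rw [h, smul_smul, inv_mul_cancel₀ hpos.ne', one_smul]
  rw [h', hlam, entryMeasure_adeleFundamentalDomain, setIntegral_entryMeasure]
  congr 1
  refine setIntegral_congr_fun measurableSet_unipotentTateDomain fun u _ => ?_
  simp only [unipotentPeriodization_mk, unipotentGL2_entry]

/-- **The constant term**: `∫_{𝔸_K ⧸ K} Φ_g = ν(𝓕_N)⁻¹ ∫_{𝓕_N} φ(u g) dν(u)`. [folklore] -/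
theorem integral_unipotentPeriodization (hφ : IsLeftInvariant (AdelicGroupData.gl 2 K) φ)
    (hφc : Continuous φ) (ν : Measure ↥(adelicUnipotent 2 K)) [IsHaarMeasure ν]
    (g : GL (Fin 2) (AdeleRing (𝓞 K) K)) :
    ∫ q, unipotentPeriodization hφ g q ∂(adeleQuotHaar K) =
      ((ν (unipotentTateDomain 2 K)).toReal⁻¹ : ℝ) •
        ∫ u in unipotentTateDomain 2 K, φ ((u : GL (Fin 2) (AdeleRing (𝓞 K) K)) * g) ∂ν := by
  have h := integral_mul_unipotentPeriodization hφ hφc ν (F := fun _ => (1 : ℂ)) continuous_const g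
  simpa only [one_mul] using h

/-- **Whittaker coefficients are Fourier coefficients.** For `φ` continuous and left
`GL₂(K)`-invariant, `ψ` Tate's character of `𝔸_K ⧸ K` and `ξ ∈ Kˣ`, the `ξ`-th Fourier
coefficient of `x + K ↦ φ(n(x) g)` is the global `ψ`-Whittaker coefficient of `φ` at `d(ξ) g`:
`∫_{𝔸_K ⧸ K} conj ψ(ξ x) φ(n(x) g) dx = W_φ(d(ξ) g)` (`whittakerCoeff` over Tate's box `𝓕_N`
with any Haar measure `ν` on `N₂(𝔸_K)`). The change of variables `x ↦ ξ x` is made on the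
compact quotient, where it preserves the Haar probability measure (`integral_comp_mulQuot`), and
`φ(n(ξ x) d(ξ) g) = φ(n(x) g)` by left invariance under `d(ξ) ∈ GL₂(K)`
(Jacquet–Langlands; Gelbart, *Automorphic forms on adele groups* (1975), §3 (3.8); Cogdell (2004),
§1.1 for `GL_n`). [folklore] -/
theorem integral_conj_adeleQuotChar_mul_unipotentPeriodization
    (hφ : IsLeftInvariant (AdelicGroupData.gl 2 K) φ) (hφc : Continuous φ)
    (ν : Measure ↥(adelicUnipotent 2 K)) [IsHaarMeasure ν] (ξ : Kˣ)
    (g : GL (Fin 2) (AdeleRing (𝓞 K) K)) :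
    ∫ q, conj (adeleQuotChar K (ξ : K) q : ℂ) * unipotentPeriodization hφ g q ∂(adeleQuotHaar K) =
      whittakerCoeff ν (unipotentTateDomain 2 K) (adeleAddChar K) φ (ratDiagGL2 K ξ * g) := by
  -- move to the base point `d(ξ) g` by the measure-preserving `q ↦ ξ q`
  have h1 : (fun q => conj (adeleQuotChar K (ξ : K) q : ℂ) * unipotentPeriodization hφ g q) =
      fun q => conj (adeleQuotChar K 1 (mulQuot K (ξ : K) q) : ℂ) *
        unipotentPeriodization hφ (ratDiagGL2 K ξ * g) (mulQuot K (ξ : K) q) := by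
    funext q
    rw [adeleQuotChar_mulQuot, one_mul, unipotentPeriodization_mulQuot]
  have h2 := integral_comp_mulQuot K ξ.ne_zero (fun q' => conj (adeleQuotChar K 1 q' : ℂ) *
    unipotentPeriodization hφ (ratDiagGL2 K ξ * g) q')
  rw [h1, h2, integral_mul_unipotentPeriodization hφ hφc ν (F := fun q => conj (adeleQuotChar K 1 q : ℂ))
    (continuous_adeleQuotChar K 1).star (ratDiagGL2 K ξ * g), whittakerCoeff_def]
  congr 1
  refine setIntegral_congr_fun measurableSet_unipotentTateDomain fun u _ => ?_
  simp only [adeleQuotChar_mk, map_one, one_mul, whittakerCharFun_fin_two, mul_comm]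

/-- **Bessel's inequality for Whittaker coefficients on `GL₂`.** For `φ` continuous and left
`GL₂(K)`-invariant, every `g ∈ GL₂(𝔸_K)`, every Haar measure `ν` on `N₂(𝔸_K)` and every finite
set of `ξ ∈ Kˣ`:
`∑_ξ |W_φ(d(ξ) g)|² ≤ ν(𝓕_N)⁻¹ ∫_{𝓕_N} |φ(u g)|² dν(u)` — the `W_φ(d(ξ) g)` being the Fourier
coefficients of `x + K ↦ φ(n(x) g)` on the compact group `𝔸_K ⧸ K`, whose total `L²`-mass is the
right-hand side (Bessel, `AdeleQuotientFourier`; the classical Hecke–Rankin starting point, e.g.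
Gelbart (1975), §3, for adelic `GL₂`). [folklore] -/
theorem sum_norm_sq_whittakerCoeff_ratDiagGL2_le
    (hφ : IsLeftInvariant (AdelicGroupData.gl 2 K) φ) (hφc : Continuous φ)
    (ν : Measure ↥(adelicUnipotent 2 K)) [IsHaarMeasure ν] (g : GL (Fin 2) (AdeleRing (𝓞 K) K))
    (s : Finset Kˣ) :
    ∑ ξ ∈ s, ‖whittakerCoeff ν (unipotentTateDomain 2 K) (adeleAddChar K) φ (ratDiagGL2 K ξ * g)‖ ^ 2 ≤
      (ν (unipotentTateDomain 2 K)).toReal⁻¹ *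
        ∫ u in unipotentTateDomain 2 K, ‖φ ((u : GL (Fin 2) (AdeleRing (𝓞 K) K)) * g)‖ ^ 2 ∂ν := by
  set Φ := unipotentPeriodization hφ g with hΦ
  have hΦc : Continuous Φ := continuous_unipotentPeriodization hφ hφc g
  -- the left-hand side as a sum of squared Fourier coefficients over `s.map val ⊆ K`
  have hlhs : ∑ ξ ∈ s, ‖whittakerCoeff ν (unipotentTateDomain 2 K) (adeleAddChar K) φ
      (ratDiagGL2 K ξ * g)‖ ^ 2 =
      ∑ ξ ∈ s.map ⟨(Units.val : Kˣ → K), Units.val_injective⟩,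
        ‖∫ q, conj (adeleQuotChar K ξ q : ℂ) * Φ q ∂(adeleQuotHaar K)‖ ^ 2 := by
    rw [Finset.sum_map]
    refine Finset.sum_congr rfl fun ξ _ => ?_
    rw [Function.Embedding.coeFn_mk, integral_conj_adeleQuotChar_mul_unipotentPeriodization hφ hφc ν ξ g]
  rw [hlhs]
  refine (sum_norm_sq_integral_conj_adeleQuotChar_mul_le K (memLp_of_continuous K hΦc) _).trans ?_
  -- the `L²`-mass of `Φ` on the fundamental domain
  rw [integral_norm_sq_eq_inv_mul K (entryMeasure ν) hΦc.aestronglyMeasurable,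
    entryMeasure_adeleFundamentalDomain, setIntegral_entryMeasure]
  refine le_of_eq ?_
  congr 1
  refine setIntegral_congr_fun measurableSet_unipotentTateDomain fun u _ => ?_
  simp only [hΦ, unipotentPeriodization_mk, unipotentGL2_entry]

/-- Bessel's inequality for Whittaker coefficients, `ℝ≥0∞`-valued form summed over all of `Kˣ`:
`∑'_{ξ ∈ Kˣ} |W_φ(d(ξ) g)|² ≤ ν(𝓕_N)⁻¹ ∫_{𝓕_N} |φ(u g)|² dν(u)`. [folklore] -/
theorem tsum_enorm_sq_whittakerCoeff_ratDiagGL2_le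
    (hφ : IsLeftInvariant (AdelicGroupData.gl 2 K) φ) (hφc : Continuous φ)
    (ν : Measure ↥(adelicUnipotent 2 K)) [IsHaarMeasure ν] (g : GL (Fin 2) (AdeleRing (𝓞 K) K)) :
    ∑' ξ : Kˣ, ‖whittakerCoeff ν (unipotentTateDomain 2 K) (adeleAddChar K) φ
        (ratDiagGL2 K ξ * g)‖ₑ ^ 2 ≤
      ENNReal.ofReal ((ν (unipotentTateDomain 2 K)).toReal⁻¹ *
        ∫ u in unipotentTateDomain 2 K, ‖φ ((u : GL (Fin 2) (AdeleRing (𝓞 K) K)) * g)‖ ^ 2 ∂ν) := by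
  rw [ENNReal.tsum_eq_iSup_sum]
  refine iSup_le fun s => ?_
  have h := sum_norm_sq_whittakerCoeff_ratDiagGL2_le hφ hφc ν g s
  have hsum : ∑ ξ ∈ s, ‖whittakerCoeff ν (unipotentTateDomain 2 K) (adeleAddChar K) φ
      (ratDiagGL2 K ξ * g)‖ₑ ^ 2 =
      ENNReal.ofReal (∑ ξ ∈ s, ‖whittakerCoeff ν (unipotentTateDomain 2 K) (adeleAddChar K) φ
        (ratDiagGL2 K ξ * g)‖ ^ 2) := by
    rw [ENNReal.ofReal_sum_of_nonneg fun ξ _ => sq_nonneg _]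
    refine Finset.sum_congr rfl fun ξ _ => ?_
    rw [ENNReal.ofReal_pow (norm_nonneg _), ofReal_norm]
  rw [hsum]
  exact ENNReal.ofReal_le_ofReal h

/-- **Cuspidal non-zero functions on `GL₂` are generic.** Let `φ` be continuous, left
`GL₂(K)`-invariant, with vanishing constant terms along `N₂` (`∫_{𝓕_N} φ(u g) dν(u) = 0` for all
`g`) and `φ ≠ 0`. Then some Whittaker coefficient `W_φ(g)` is non-zero: otherwise all Fourier
coefficients of the continuous function `x + K ↦ φ(n(x) g)` vanish, so it vanishes identically
(completeness of the characters of `𝔸_K ⧸ K`, `AdeleQuotientFourier`) and `φ(g) = 0` for every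
`g`. [folklore] -/
theorem exists_whittakerCoeff_ne_zero_of_cuspidal
    (hφ : IsLeftInvariant (AdelicGroupData.gl 2 K) φ) (hφc : Continuous φ)
    (ν : Measure ↥(adelicUnipotent 2 K)) [IsHaarMeasure ν]
    (hcusp : ∀ g : GL (Fin 2) (AdeleRing (𝓞 K) K),
      ∫ u in unipotentTateDomain 2 K, φ ((u : GL (Fin 2) (AdeleRing (𝓞 K) K)) * g) ∂ν = 0)
    (hne : φ ≠ 0) :
    ∃ g : GL (Fin 2) (AdeleRing (𝓞 K) K),
      whittakerCoeff ν (unipotentTateDomain 2 K) (adeleAddChar K) φ g ≠ 0 := by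
  by_contra hW
  simp only [not_exists, ne_eq, not_not] at hW
  apply hne
  funext g
  set Φ := unipotentPeriodization hφ g with hΦ
  have hΦc : Continuous Φ := continuous_unipotentPeriodization hφ hφc g
  have hzero : Φ = 0 := by
    refine eq_zero_of_forall_integral_conj_adeleQuotChar_mul_eq_zero K hΦc fun ξ => ?_
    by_cases hξ : ξ = 0
    · subst hξ
      have h0 : adeleQuotChar K (0 : K) = 0 := map_zero (adeleQuotCharHom K)
      have h1 : (fun q => conj (adeleQuotChar K (0 : K) q : ℂ) * Φ q) = Φ := by
        funext q
        rw [h0, AddChar.zero_apply, Circle.coe_one, map_one, one_mul]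
      rw [h1, hΦ, integral_unipotentPeriodization hφ hφc ν g, hcusp g, smul_zero]
    · have h := integral_conj_adeleQuotChar_mul_unipotentPeriodization hφ hφc ν (Units.mk0 ξ hξ) g
      rw [Units.val_mk0] at h
      rw [h]
      exact hW _
  have := congrFun hzero (QuotientAddGroup.mk 0)
  rw [hΦ, unipotentPeriodization_mk, unipotentGL2_zero, OneMemClass.coe_one, one_mul] at this
  exact this

end Fourier

end Adelic

end Literature.NumberTheory.Automorphic
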